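import Summits.RiemannHypothesis.RiemannHypothesis.Theorems.Splittings.RobinFiniteE1cUpperCore
import HarnessLib

/-!
# E1c⁺ part 3 — `log f < 0` windows (U6); Nicolas's inequality at `p#` for every prime `p ≤ 1.5·10⁹` from RH up to `10⁵` / unconditionally
# (U7); `p ≤ 6·10¹³` from RH up to the Platt–Trudgian height (U8); the φ-side HEIGHT LAW `X ≤ min(14·T²/log²T, 10¹²)` for any `T ≥ 10⁵` (U9)

Pub cell `rh-split` (robin, finite) gen 10, CARVE-g10 part 3/3 of the checked object `SketchG10-Upper.lean` (bodies verbatim,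
one shared namespace `Summit.RiemannHypothesis.RiemannHypothesis.Theorems.Splittings.RobinFiniteE1c`).  Zero `def`, zero `sorry`,
no `native_decide` in this file; everything RH-shaped is a HYPOTHESIS `RiemannHypothesisUpTo T` (STD-ONLY variant of part 3: the instance
discharged by the tree theorem `riemannHypothesisUpTo_100000` is omitted; file it instead of part 3 if the proof lane refuses inherited
`native_decide` axioms).
SPLITTING SEARCH over kernel-typed RH-EQUIVALENCES; a splitting A ∧ B ⟹ RH is CONDITIONAL bookkeeping unless A and B are
both proved; nothing here bears on the truth of RH.
-/

set_option linter.dupNamespace false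

noncomputable section

open Complex Filter Set MeasureTheory Topology intervalIntegral
open scoped Real Chebyshev ComplexConjugate

namespace Summit.RiemannHypothesis.RiemannHypothesis.Theorems.Splittings.RobinFiniteE1c

open Literature.NumberTheory.LFunctions Literature.NumberTheory.DiophantineGeometry
open Nicolas NicolasJ NicolasFz NicolasK NicolasJExplicit

/-! ### U6 · E1c⁺ ⟹ φ-currency exchange: `log f(x) < 0` on a window, under RH up to `T` and a zero-tail bound `h` -/

/-- **The windowed exchange statement** (g10; the φ-currency `ExchangePhi` of the card, with both inputs as hypotheses):
RH up to height `T`, the RH-free tail bound `Σ_{|Im ρ|>T} m(ρ)/(Im ρ)² ≤ h` (a THEOREM for every `T ≥ 7`,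
`RobinFiniteTail.zeroTailBound_tailH`) and a window `[X₀, X₁] ⊆ [599², 8886113²]` with brackets `s₀² ≤ X₀`, `X₁ ≤ s₁²`,
`2.7182818286^{n₀} ≤ X₀`, `X₁ ≤ 2.7182818283^{n₁}` whose window constant is `< 1.6` give `log f(x) < 0` on the window.
No named fact; nothing RH-shaped except `RiemannHypothesisUpTo T` in hypothesis position. -/
theorem log_nicolasF_neg_window {T h x X₀ X₁ s₀ s₁ : ℝ} {n₀ n₁ : ℕ}
    (hT : RiemannHypothesisUpTo T)
    (htail : ∑' ρ : RHWave0.riemannZetaNontrivialZeros,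
        (if T < |(ρ : ℂ).im| then (riemannZetaZeroOrder (ρ : ℂ) : ℝ) / (ρ : ℂ).im ^ 2 else 0) ≤ h)
    (hh : 0 ≤ h) (hX₀ : 358801 ≤ X₀) (hX₁ : X₁ ≤ 8886113 ^ 2) (hx : X₀ ≤ x) (hx' : x ≤ X₁)
    (hs₀ : 0 < s₀) (hs₀' : s₀ ^ 2 ≤ X₀) (hs₁ : X₁ ≤ s₁ ^ 2) (hs₁0 : 0 ≤ s₁)
    (hn₀ : (2.7182818286 : ℝ) ^ n₀ ≤ X₀) (hn₁ : X₁ ≤ (2.7182818283 : ℝ) ^ n₁) (hn₀1 : 1 ≤ n₀)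
    (hnum : 1.6 / (n₀ : ℝ) + 0.8 * 7.3e-9 * s₁ * n₁ + 0.0463 * (1 + (1 + 4 / (n₀ : ℝ)) / n₀)
      + (1 + 2 / (n₀ : ℝ)) * h * s₁ + 4 * (n₁ : ℝ) / s₀ < 1.6) :
    Real.log (nicolasF x) < 0 := by
  have hxl : 358801 ≤ x := hX₀.trans hx
  have hxB : x ≤ 8886113 ^ 2 := hx'.trans hX₁
  have hx0 : 0 < x := by linarith
  have hx1 : (1 : ℝ) ≤ x := by linarith
  have hoff := offLineSumAt_of_zeroTailBound htail hx1
  have hcore := corePwUpper hxl hxB hT hoff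
  rw [Dx] at hcore
  refine lt_of_le_of_lt hcore (upper_budget_neg (s := Real.sqrt x) (ℓ := Real.log x) (ℓ₀ := n₀) (ℓ₁ := n₁)
    hs₀ (by exact_mod_cast hn₀1) hh (by norm_num) ?_ ?_ ?_ ?_ ?_ le_rfl Fhalf_Ysq_le hnum)
  · calc s₀ = Real.sqrt (s₀ ^ 2) := (Real.sqrt_sq hs₀.le).symm
      _ ≤ Real.sqrt x := Real.sqrt_le_sqrt (hs₀'.trans hx)
  · calc Real.sqrt x ≤ Real.sqrt (s₁ ^ 2) := Real.sqrt_le_sqrt (hx'.trans hs₁)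
      _ = s₁ := Real.sqrt_sq hs₁0
  · exact natCast_le_log hn₀ (by linarith) hx
  · exact log_le_natCast hn₁ hx0 hx'
  · exact (Real.mul_self_sqrt hx0.le).symm

/-! ### U7 · from `log f(p) < 0` to Nicolas's inequality at `p#`; the kernel headline -/

/-- `log f(p) < 0 ⟹ e^γ log log(p#) < (p#)/φ(p#)` (`f(p) = e^γ log log N · φ(N)/N`, `N = p#`; `Nicolas.nicolasF_natCast_eq`);
the last lines of `NicolasUpper.nicolasInequality_primorial_of_RH_of_le`, verbatim. -/
theorem nicolasInequality_of_log_nicolasF_neg {p : ℕ} (hp3 : (3 : ℝ) ≤ p) (hlog : Real.log (nicolasF p) < 0) :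
    nicolasInequality (primorial p) := by
  have hf0 : 0 < nicolasF p := nicolasF_pos hp3
  have hf1 : nicolasF p < 1 := (Real.log_neg_iff hf0).1 hlog
  rw [nicolasF_natCast_eq p] at hf1
  have hN0 : (0 : ℝ) < primorial p := by exact_mod_cast primorial_pos p
  have hφ0 : (0 : ℝ) < Nat.totient (primorial p) := by exact_mod_cast Nat.totient_pos.2 (primorial_pos p)
  rw [nicolasInequality, lt_div_iff₀ hφ0]
  have := mul_lt_mul_of_pos_right hf1 hN0
  rw [one_mul] at this
  calc Real.exp Real.eulerMascheroniConstant * Real.log (Real.log (primorial p)) * Nat.totient (primorial p)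
      = Real.exp Real.eulerMascheroniConstant * Real.log (Real.log (primorial p)) *
          ((Nat.totient (primorial p) : ℝ) / primorial p) * primorial p := by
        field_simp
    _ < primorial p := this

/-- **`log f(x) < 0` for every real `x ∈ [599², 1.5·10⁹]` under RH up to height `10⁵` ONLY** (standard axioms): the tail
bound at `10⁵` is the tree's theorem `RobinFiniteTail.zeroTailBound_1e5` (`≤ 3.42·10⁻⁵`, RH-free), the `θ`-input is the kernel table
`abs_theta_sub_le_smallRange`; four windows `[599², 10⁶] ∪ [10⁶, 10⁸] ∪ [10⁸, 10⁹] ∪ [10⁹, 1.5·10⁹]`. -/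
theorem log_nicolasF_neg_of_rh1e5 (hT : RiemannHypothesisUpTo 100000) {x : ℝ} (hx : 358801 ≤ x) (hx' : x ≤ 1.5e9) :
    Real.log (nicolasF x) < 0 := by
  have ht := RobinFiniteTail.zeroTailBound_1e5
  have hh : (0 : ℝ) ≤ 3.42e-5 := by norm_num
  rcases le_or_gt x 1e6 with h6 | h6
  · exact log_nicolasF_neg_window (X₀ := 358801) (X₁ := 1e6) (s₀ := 599) (s₁ := 1000) (n₀ := 12) (n₁ := 14)
      hT ht hh le_rfl (by norm_num) hx h6 (by norm_num) (by norm_num) (by norm_num) (by norm_num) (by norm_num)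
      (by norm_num) (by norm_num) (by norm_num)
  rcases le_or_gt x 1e8 with h8 | h8
  · exact log_nicolasF_neg_window (X₀ := 1e6) (X₁ := 1e8) (s₀ := 1000) (s₁ := 10000) (n₀ := 13) (n₁ := 19)
      hT ht hh (by norm_num) (by norm_num) h6.le h8 (by norm_num) (by norm_num) (by norm_num) (by norm_num) (by norm_num)
      (by norm_num) (by norm_num) (by norm_num)
  rcases le_or_gt x 1e9 with h9 | h9
  · exact log_nicolasF_neg_window (X₀ := 1e8) (X₁ := 1e9) (s₀ := 10000) (s₁ := 31623) (n₀ := 18) (n₁ := 21)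
      hT ht hh (by norm_num) (by norm_num) h8.le h9 (by norm_num) (by norm_num) (by norm_num) (by norm_num) (by norm_num)
      (by norm_num) (by norm_num) (by norm_num)
  · exact log_nicolasF_neg_window (X₀ := 1e9) (X₁ := 1.5e9) (s₀ := 31622) (s₁ := 38730) (n₀ := 20) (n₁ := 22)
      hT ht hh (by norm_num) (by norm_num) h9.le hx' (by norm_num) (by norm_num) (by norm_num) (by norm_num) (by norm_num)
      (by norm_num) (by norm_num) (by norm_num)

/-- **E1c⁺ ⟹ φ-currency exchange at the kernel height (standard axioms)**: RH up to height `10⁵` ALONE implies Nicolas's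
inequality `e^γ log log N_k < N_k/φ(N_k)` at the primorial `N_k = p#` of every prime `p ≤ 1.5·10⁹` (below `360649` the kernel chain
`nicolasInequality_primorial_of_le`; above it `log_nicolasF_neg_of_rh1e5`).  `RiemannHypothesisUpTo 100000` in HYPOTHESIS position. -/
theorem nicolasInequality_primorial_of_rh1e5 (hT : RiemannHypothesisUpTo 100000) {p : ℕ} (hp : p.Prime)
    (hle : p ≤ 1500000000) : nicolasInequality (primorial p) := by
  rcases le_or_gt p 360649 with h | h
  · exact nicolasInequality_primorial_of_le hp h
  · have hpR : (358801 : ℝ) ≤ p := by exact_mod_cast (show 358801 ≤ p by omega)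
    have hpR' : (p : ℝ) ≤ 1.5e9 := by
      have : (p : ℝ) ≤ 1500000000 := by exact_mod_cast hle
      linarith
    exact nicolasInequality_of_log_nicolasF_neg (by linarith) (log_nicolasF_neg_of_rh1e5 hT hpR hpR')

/-- The same below any larger verified height (`RiemannHypothesisUpTo` is antitone in the height). -/
theorem nicolasInequality_primorial_of_rhUpTo {T : ℝ} (hT100000 : 100000 ≤ T) (hT : RiemannHypothesisUpTo T) {p : ℕ}
    (hp : p.Prime) (hle : p ≤ 1500000000) : nicolasInequality (primorial p) :=
  nicolasInequality_primorial_of_rh1e5 (fun s hs h0 hsT ↦ hT s hs h0 (hsT.trans hT100000)) hp hle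

/-! ### U8 · the Platt–Trudgian-height row (CONDITIONAL on RH up to `3 000 175 332 800`, a print theorem typed as a hypothesis) -/

/-- **Conditional row at the Platt–Trudgian height**: RH up to `H_PT = 3 000 175 332 800` (Platt–Trudgian 2021 — a PRINT theorem,
here a HYPOTHESIS; not a tree theorem) implies `log f(x) < 0` for every real `x ∈ [599², 6·10¹³]`, with NO other input: the tail bound
`RobinFiniteTail.zeroTailBound_PT` (`≤ 2.961·10⁻¹²`) and the `θ`-table are kernel theorems.  Below `1.5·10⁹` by antitonicity from the
`10⁵` windows; on `[1.5·10⁹, 6·10¹³]` one window (the budget is spent on the truncation loss `(4/5)F_{1/2}(8886113²)·√x log x`,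
which is why the device stops near `8886113² ≈ 7.9·10¹³` — beyond it one imports Büthe 2018 Thm 2 exactly as E1c⁻ does). -/
theorem log_nicolasF_neg_of_rhPT (hPT : RiemannHypothesisUpTo 3000175332800) {x : ℝ} (hx : 358801 ≤ x) (hx' : x ≤ 6e13) :
    Real.log (nicolasF x) < 0 := by
  rcases le_or_gt x 1.5e9 with h15 | h15
  · exact log_nicolasF_neg_of_rh1e5 (fun s hs h0 hsT ↦ hPT s hs h0 (hsT.trans (by norm_num))) hx h15
  · exact log_nicolasF_neg_window (X₀ := 1.5e9) (X₁ := 6e13) (s₀ := 38729) (s₁ := 7745967) (n₀ := 21) (n₁ := 32)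
      hPT RobinFiniteTail.zeroTailBound_PT (by norm_num) (by norm_num) (by norm_num) h15.le hx' (by norm_num) (by norm_num)
      (by norm_num) (by norm_num) (by norm_num) (by norm_num) (by norm_num) (by norm_num)

/-- **Platt–Trudgian ⟹ Nicolas's inequality at `p#` for every prime `p ≤ 6·10¹³`** (standard axioms; the ONLY hypothesis is
`RiemannHypothesisUpTo 3000175332800`).  CONDITIONAL bookkeeping row; nothing here bears on the truth of RH. -/
theorem nicolasInequality_primorial_of_rhPT (hPT : RiemannHypothesisUpTo 3000175332800) {p : ℕ} (hp : p.Prime)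
    (hle : p ≤ 60000000000000) : nicolasInequality (primorial p) := by
  rcases le_or_gt p 360649 with h | h
  · exact nicolasInequality_primorial_of_le hp h
  · have hpR : (358801 : ℝ) ≤ p := by exact_mod_cast (show 358801 ≤ p by omega)
    have hpR' : (p : ℝ) ≤ 6e13 := by
      have : (p : ℝ) ≤ 60000000000000 := by exact_mod_cast hle
      linarith
    exact nicolasInequality_of_log_nicolasF_neg (by linarith) (log_nicolasF_neg_of_rhPT hPT hpR hpR')

/-! ### U9 · the φ-side HEIGHT LAW: every verified height `T ≥ 10⁵` buys Nicolas's inequality for `p ≤ min(14·T²/log²T, 10¹²)` -/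

/-- **Closed form of the kernel tail price** for `T ≥ 10⁵`: `(log(T/2π) + 1)/(πT) + (184 + 30 log T)/T² ≤ log T/(πT)`
(the tree's `RobinFiniteTail.zeroTailBound_tailH` bound; `log(2π) ≥ 1.8378` (tree `SchoenfeldLarge.log_two_pi_ge`) absorbs the
second-order term since `π(184 + 60√T) ≤ 0.7·T` for `T ≥ 10⁵`). -/
theorem tailPrice_le_log_div {T : ℝ} (hT : 100000 ≤ T) :
    (Real.log (T / (2 * π)) + 1) / (π * T) + (184 + 30 * Real.log T) / T ^ 2 ≤ Real.log T / (π * T) := by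
  have hπ := Real.pi_pos
  have hπ' := Real.pi_lt_d6
  have hT0 : 0 < T := by linarith
  have h2π := SchoenfeldLarge.log_two_pi_ge  -- tree: `1.8378 ≤ log(2π)` (kernel log enclosures)
  have hsT : 316 ≤ Real.sqrt T := by
    calc (316 : ℝ) = Real.sqrt (316 ^ 2) := (Real.sqrt_sq (by norm_num)).symm
      _ ≤ Real.sqrt T := Real.sqrt_le_sqrt (by linarith)
  have hsT0 : 0 < Real.sqrt T := by linarith
  have hsq : Real.sqrt T * Real.sqrt T = T := Real.mul_self_sqrt hT0.le
  have hlogT : Real.log T ≤ 2 * Real.sqrt T := by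
    have h1 : Real.log (Real.sqrt T) ≤ Real.sqrt T - 1 := Real.log_le_sub_one_of_pos hsT0
    have h2 : Real.log T = 2 * Real.log (Real.sqrt T) := by
      conv_lhs => rw [← hsq]
      rw [Real.log_mul hsT0.ne' hsT0.ne']; ring
    linarith
  have hdiv : Real.log (T / (2 * π)) = Real.log T - Real.log (2 * π) :=
    Real.log_div hT0.ne' (by positivity)
  have h1 : (Real.log (T / (2 * π)) + 1) / (π * T) ≤ (Real.log T - 0.7) / (π * T) :=
    div_le_div_of_nonneg_right (by rw [hdiv]; linarith) (by positivity)
  have h2 : (184 + 30 * Real.log T) / T ^ 2 ≤ 0.7 / (π * T) := by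
    rw [div_le_div_iff₀ (by positivity) (by positivity)]
    have hk : π * (184 + 60 * Real.sqrt T) ≤ 0.7 * T := by
      have hnn : (0 : ℝ) ≤ 184 + 60 * Real.sqrt T := by positivity
      have hπk : π * (184 + 60 * Real.sqrt T) ≤ 3.141593 * (184 + 60 * Real.sqrt T) :=
        mul_le_mul_of_nonneg_right hπ'.le hnn
      nlinarith [mul_nonneg (sub_nonneg.2 hsT) (sub_nonneg.2 hsT), hsq]
    calc (184 + 30 * Real.log T) * (π * T) = π * (184 + 30 * Real.log T) * T := by ring
      _ ≤ π * (184 + 60 * Real.sqrt T) * T := by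
          apply mul_le_mul_of_nonneg_right _ hT0.le
          exact mul_le_mul_of_nonneg_left (by linarith) hπ.le
      _ ≤ 0.7 * T * T := mul_le_mul_of_nonneg_right hk hT0.le
      _ = 0.7 * T ^ 2 := by ring
  calc (Real.log (T / (2 * π)) + 1) / (π * T) + (184 + 30 * Real.log T) / T ^ 2
      ≤ (Real.log T - 0.7) / (π * T) + 0.7 / (π * T) := add_le_add h1 h2
    _ = Real.log T / (π * T) := by rw [← add_div, sub_add_cancel]

/-- **The φ-side height law, analytic part**: RH up to `T ≥ 10⁵` (hypothesis) gives `log f(x) < 0` for every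
`x ∈ [1.5·10⁹, X]` whenever `X ≤ 14·T²/log²T` and `X ≤ 10¹²` — the tail price in CLOSED FORM (`tailPrice_le_log_div`), one
window with `s₁ = √X`, budget `0.0762 + 0.1635 + 0.0489 + 1.3046 + 0.0029 < 1.6`.  Standard axioms; no named fact. -/
theorem log_nicolasF_neg_of_height {T X x : ℝ} (hT : 100000 ≤ T) (hRH : RiemannHypothesisUpTo T)
    (hX : X ≤ 14 * T ^ 2 / Real.log T ^ 2) (hX12 : X ≤ 1e12) (hx : 1.5e9 ≤ x) (hx' : x ≤ X) :
    Real.log (nicolasF x) < 0 := by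
  have htail := RobinFiniteTail.zeroTailBound_tailH (T := T) (by linarith)
  have hh0 := RobinFiniteTail.tailH_nonneg (T := T) (by linarith)
  set h := (Real.log (T / (2 * π)) + 1) / (π * T) + (184 + 30 * Real.log T) / T ^ 2 with hh_def
  have hT0 : 0 < T := by linarith
  have hlogT : 0 < Real.log T := Real.log_pos (by linarith)
  have hprice : h ≤ Real.log T / (π * T) := tailPrice_le_log_div hT
  have hX0 : 0 ≤ X := by linarith
  have hsX : Real.sqrt X ≤ 3.7417 * T / Real.log T := by
    have h14 : X ≤ (3.7417 * T / Real.log T) ^ 2 := by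
      refine hX.trans ?_
      rw [div_pow, mul_pow]
      exact div_le_div_of_nonneg_right (mul_le_mul_of_nonneg_right (by norm_num) (sq_nonneg T)) (by positivity)
    calc Real.sqrt X ≤ Real.sqrt ((3.7417 * T / Real.log T) ^ 2) := Real.sqrt_le_sqrt h14
      _ = 3.7417 * T / Real.log T := Real.sqrt_sq (by positivity)
  have hDX : h * Real.sqrt X ≤ 1.1911 := by
    calc h * Real.sqrt X ≤ Real.log T / (π * T) * (3.7417 * T / Real.log T) :=
          mul_le_mul hprice hsX (Real.sqrt_nonneg _) (by positivity)
      _ = 3.7417 / π := by field_simp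
      _ ≤ 1.1911 := by rw [div_le_iff₀ Real.pi_pos]; nlinarith [Real.pi_gt_d6]
  have hsX6 : Real.sqrt X ≤ 1e6 := by
    calc Real.sqrt X ≤ Real.sqrt (1e6 ^ 2) := Real.sqrt_le_sqrt (hX12.trans (by norm_num))
      _ = 1e6 := Real.sqrt_sq (by norm_num)
  have hx0 : 0 < x := by linarith
  have hx1 : (1 : ℝ) ≤ x := by linarith
  have hxl : 358801 ≤ x := by linarith
  have hxB : x ≤ 8886113 ^ 2 := by linarith
  have hoff := offLineSumAt_of_zeroTailBound htail hx1
  have hcore := corePwUpper hxl hxB hRH hoff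
  rw [Dx] at hcore
  refine lt_of_le_of_lt hcore (upper_budget_neg (s := Real.sqrt x) (ℓ := Real.log x) (ℓ₀ := 21) (ℓ₁ := 28)
    (s₀ := 38729) (s₁ := Real.sqrt X) (ε := 7.3e-9)
    (by norm_num) (by norm_num) hh0 (by norm_num) ?_ ?_ ?_ ?_ ?_ le_rfl Fhalf_Ysq_le ?_)
  · calc (38729 : ℝ) = Real.sqrt (38729 ^ 2) := (Real.sqrt_sq (by norm_num)).symm
      _ ≤ Real.sqrt x := Real.sqrt_le_sqrt (by linarith)
  · exact Real.sqrt_le_sqrt hx'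
  · have := natCast_le_log (n := 21) (X := 1.5e9) (by norm_num) (by norm_num) hx
    exact_mod_cast this
  · have := log_le_natCast (n := 28) (X := 1e12) (by norm_num) hx0 (hx'.trans hX12)
    exact_mod_cast this
  · exact (Real.mul_self_sqrt hx0.le).symm
  · have hE : 0.8 * 7.3e-9 * Real.sqrt X * 28 ≤ 0.16352 := by nlinarith [hsX6, Real.sqrt_nonneg X]
    have hD : (1 + 2 / (21 : ℝ)) * h * Real.sqrt X ≤ 1.30456 := by
      have : (1 + 2 / (21 : ℝ)) * h * Real.sqrt X = (1 + 2 / 21) * (h * Real.sqrt X) := by ring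
      rw [this]; nlinarith [hDX]
    have hc : (1.6 : ℝ) / 21 + 0.0463 * (1 + (1 + 4 / 21) / 21) + 4 * 28 / 38729 < 1.6 - 0.16352 - 1.30456 := by
      norm_num
    linarith [hE, hD, hc]

/-- **THE φ-SIDE HEIGHT LAW (g10)**: for ANY height `T ≥ 10⁵` to which RH is known (hypothesis `RiemannHypothesisUpTo T`),
Nicolas's inequality holds at the primorial of every prime `p ≤ X` as soon as `X ≤ 14·T²/log²T` and `X ≤ 10¹²` — monotone in
`T`, no named fact, standard axioms.  In numbers: `T = 2·10⁵ ↦ 3.7·10⁹`, `10⁶ ↦ 7.3·10¹⁰`, `4·10⁶ ↦ 10¹²` (cap; the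
`6·10¹³` row `nicolasInequality_primorial_of_rhPT` takes over at the Platt–Trudgian height).  The exchange rate
`X ∝ T²/log²T` is the φ-twin of the CA-side law `2.156·T²/log²T` of the card's §16.  CONDITIONAL bookkeeping for every `T`
beyond the tree's certificate; nothing here bears on the truth of RH. -/
theorem nicolasInequality_primorial_of_height {T X : ℝ} (hT : 100000 ≤ T) (hRH : RiemannHypothesisUpTo T)
    (hX : X ≤ 14 * T ^ 2 / Real.log T ^ 2) (hX12 : X ≤ 1e12) {p : ℕ} (hp : p.Prime) (hpX : (p : ℝ) ≤ X) :
    nicolasInequality (primorial p) := by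
  rcases le_or_gt p 1500000000 with hle | hgt
  · exact nicolasInequality_primorial_of_rhUpTo hT hRH hp hle
  · have hpR : (1.5e9 : ℝ) ≤ p := by
      have : (1500000001 : ℝ) ≤ p := by exact_mod_cast hgt
      linarith
    exact nicolasInequality_of_log_nicolasF_neg (by linarith) (log_nicolasF_neg_of_height hT hRH hX hX12 hpR hpX)

end Summit.RiemannHypothesis.RiemannHypothesis.Theorems.Splittings.RobinFiniteE1c

end
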